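import Literature.MathematicalPhysics.QuantumFieldTheory.Balaban1983to89.T3MinimiserStabilityReduction
import Literature.MathematicalPhysics.QuantumFieldTheory.Balaban1983to89.T3PrintedRegularMinimiser
import Literature.MathematicalPhysics.QuantumFieldTheory.Balaban1983to89.T3OrbitAverage
import Literature.MathematicalPhysics.QuantumFieldTheory.Balaban1983to89.B12ContinuousTransportInvariance
import Literature.MathematicalPhysics.QuantumFieldTheory.Balaban1983to89.Node00.CanonicalTransportOfRecord
import Literature.MathematicalPhysics.QuantumFieldTheory.Balaban1983to89.TreeLengthTorusTwoPoint
import Summits.QuantumFields.YangMills.Theorems.FluctuationComparisonRegPrIntLBackgroundFormCellGasKnit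
import HarnessLib

/-!
# LINE g24-4 «background form» v2 — THE GAS KNIT, COLLAR EDITION (GASᵇᵍ∘ v2.1): analyticity only on the `2Rₐ`-collar of the real window backgrounds (texts inline, def-free)

Cell `ym3-torus` (YM ladder rung R3 = continuum `SU(2)` Yang–Mills on the three-torus — a RUNG, NOT d = 4, NOT infinite volume, NOT a mass gap, NOT Clay).  Width seat
`ym-ust-20520-w3` (gen 21, LEAD-20520 by lineage); `--supports stmt-QuantumFields-20520 --as helper`, count-neutral, definition-free, default heartbeats.

WHY A v2.1 OF MY OWN LETTER.  ✓`…BackgroundFormCellGasKnit` (p777065) typed GASᵇᵍ∘ v2 with a PRODUCT DOMAIN `Π_e D e` on the global register space (each `D e` open and containing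
the `2Rₐ`-balls about `M U e ↪ ℂ⁸` for EVERY window field `U`) — convenient for the glue, but STRONGER than print: `Π_e ⋃_U ball (M U e) (2Rₐ)` contains configurations
whose bond registers come from DIFFERENT window backgrounds bond by bond, and Bałaban's analyticity domains ([Balaban1987RG1] (1.11)–(1.14) p.262) are neighbourhoods of genuine
small-field backgrounds cut out by PLAQUETTE conditions, not products of per-bond discs.  The print-faithful letter is w5-20520 g20's collar philosophy, globally: holomorphy and
the majorants ONLY on the COLLAR `𝒲 := {q | ∃ U window, dist q (M U ↪ ℂ⁸) < 2Rₐ}` (sup metric) = the union of the `2Rₐ`-polydiscs about the real register configurations of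
window fields.  GASᵇᵍ∘ v2.1 := GASᵇᵍ∘ v2 with `D`, `IsOpen (D e)` and the per-bond collar clause DELETED and the four analytic clauses read on `𝒲` (everything else — frame, constants,
`c₀ d blk M Ncb ecb 𝒮 act`, (d1)–(d6), localities, support, realness, (r1), (r2), (rep) — BYTE-IDENTICAL to v2, HOME `g21/TEXT-GASbg-v2.w3g21.lean`).  Text: HOME
`g21/TEXT-GASbg-v2_1.w3g21.lean`.

CONTENT.  ★★★ `backgroundFormCellAnalytic_of_gasCollar : ⟨GASᵇᵍ∘ v2.1⟩ → ⟨BGFORMᵃ∘ v2 VERBATIM (w5 g20 v1.1 text 221b2a5fa5f0aca3 = ✓p776960's `hA`)⟩` with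
`Dom X := {p | ∃ U window, dist p (M U|_X ↪ ℂ⁸) < 2Rₐ}` (OPEN: a union of balls; BGFORMᵃ∘ v2's collar clause is then `⟨U, hU, hp⟩`), the SAME `𝒯 X`, `Bx X` and constants as
v2, and the glue taken PER WINDOW FIELD: on the ball about `M U|_X` every fibre term is read through `ext_U` (registers of `X`'s blocks, `M U e ↪ ℂ⁸` elsewhere), which maps that
ball INTO `𝒲` (`dist_pi_lt_iff`) and agrees with the `U`-free definition by LOCALITY; holomorphy on `Dom X` is local (`DifferentiableOn.congr` on each ball + `IsOpen.mem_nhds`)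
from ✓(I″) `differentiableOn_locE_param_tthree` at parameter space `P_X` on the ball; envelope, support, pins ((1.26) at one∕two marked cubes + (d6)), realness and the
representation as in v2 (✓`locE_param_real`, `Finset.sum_fiberwise`).  (⟨GASᵇᵍ∘ v2⟩ → ⟨GASᵇᵍ∘ v2.1⟩ is immediate — the product domain contains `𝒲` by `dist_le_pi_dist`,
`DifferentiableOn.mono` — so every v2 supplier, e.g. w5 g20's (RESPᵛ²), feeds this knit too; not restated as a theorem.)
HONEST: plumbing between HYPOTHESIS rows; GASᵇᵍ∘ v2.1 ∕ v2 ∕ BGFORMᵃ∘ v2 ∕ BGFORM∘ v2 are docking rows, NOT proved; nothing of Bałaban's asserted; S2β ∕ GRAD∘ ∕ the five registered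
∘-stubs (v11.4 0∕5, №36 intact) ∕ `FluctuationComparisonRegPrIntL` (20520) ∕ `YM3TorusSU2` NOT proved; no summit is proved by a helper.  Sorry-free, axioms standard.
[cite: Balaban1987RG1, (0.22)-(0.25) pp.256-257 and (1.11)-(1.14) p.262; Balaban1988RG2Cluster, (1.26) p.8, (2.11)-(2.13) p.14, (2.41) p.21; Balaban1989LargeFieldII, (1.98)-(1.100) p.390; Balaban1985Variational, Prop. 9 p.309; KoteckyPreiss1986, Theorem p.492]
-/

set_option autoImplicit false

noncomputable section

namespace Summit.QuantumFields.YangMills.Theorems.FluctuationComparisonRegPrIntLBackgroundFormCellGasCollarKnit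

open MeasureTheory Filter Topology Set
open scoped BigOperators
open Literature.MathematicalPhysics.QuantumFieldTheory.Balaban1983to89
open Literature.MathematicalPhysics.QuantumFieldTheory.Balaban1983to89.T3ContinuumYM3Torus T3NestedUnitLaws T3UnitLawDensityEML T3UnitScaleTilt T3TiltDescent
  T3PrintedRegularMinimiser T3LevelShift Missing T4Continuum
open Literature.MathematicalPhysics.QuantumFieldTheory.Balaban1983to89.TreeLengthTorus (TPt TDom IsTDom tsys TFaceConnected torusTreeLen torusTreeLen_nonneg sum_exp_torusTreeLen_le sum_exp_torusTreeLen_two_sites_le)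
open Literature.MathematicalPhysics.QuantumFieldTheory.Balaban1983to89.TreeLengthTorusGeometry (TTouch tgeometry ttouch_refl ttouch_symm tgeometry_consts)
open Literature.MathematicalPhysics.QuantumFieldTheory.Balaban1983to89.B12TreeDecay (kappa₀ K₀ kappa₀_nonneg K₀_pos)
open Literature.MathematicalPhysics.QuantumFieldTheory.Balaban1983to89.B12Decay510Torus (pl1 tcubeOf)
open Literature.MathematicalPhysics.QuantumFieldTheory.Balaban1983to89.B13Resummation (locE locE_congr)
open Literature.Probability.LatticeModels
open Summit.QuantumFields.YangMills.Theorems.FluctuationComparisonRegPrIntLPolymerMayerGas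
open Summit.QuantumFields.YangMills.Theorems.FluctuationComparisonRegPrIntLPolymerMayerGasParam

open Summit.QuantumFields.YangMills.Theorems.FluctuationComparisonRegPrIntLBackgroundFormCellGasKnit (differentiable_cellExt)

set_option maxHeartbeats 400000 in
open Classical in
/-- ★★★ **GASᵇᵍ∘ v2.1 → BGFORMᵃ∘ v2** (hypothesis = the collar edition GASᵇᵍ∘ v2.1, text above; conclusion = w5-20520 g20's BGFORMᵃ∘ v2 v1.1 text 221b2a5fa5f0aca3 VERBATIM).
Witnesses as in ✓`…CellGasKnit.backgroundFormCellAnalytic_of_gas` except `Dom X := {p | ∃ U window, dist p (M U|_X ↪ ℂ⁸) < 2Rₐ}`; the glue is taken per window field (`ext_U`) and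
identified with the `U`-free term by locality. [cite: Balaban1988RG2Cluster, (1.26) p.8, (2.11)-(2.13) p.14, (2.41) p.21; Balaban1987RG1, (0.22)-(0.25) pp.256-257 and (1.11)-(1.14) p.262; Balaban1989LargeFieldII, (1.98)-(1.100) p.390; KoteckyPreiss1986, Theorem p.492] -/
theorem backgroundFormCellAnalytic_of_gasCollar
    (hG :
      ∀ (L : ℕ), ∃ pS : ℝ, ∀ (b₀ p₀ : ℝ), 0 < b₀ → pS ≤ p₀ → 0 < p₀ → ∃ ε₁ : ℝ, 0 < ε₁ ∧ ∀ (ε₀ : ℝ), 0 < ε₀ → ε₀ ≤ ε₁ →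
        ∃ γ₁ : ℝ, 0 < γ₁ ∧ ∃ (κ μ C As Ag R r₁ Rₐ : ℝ) (Mc : ℕ) (_ : NeZero Mc), 0 < κ ∧ 0 ≤ μ ∧ 0 ≤ As ∧ 0 ≤ Ag ∧ 0 < Rₐ ∧
          2 * kappa₀ (4 * 2 ^ 3) (2 * 3) ≤ r₁ ∧ r₁ + 2 * kappa₀ (4 * 2 ^ 3) (2 * 3) + 2 ≤ R ∧
          Ag * Real.exp (5 * r₁ + 1) * K₀ (4 * 2 ^ 3) (2 * 3) * 7 * 32 ≤ 1 ∧ ∀ (F : T3Family) (γ : ℝ), F.L = L → 0 < γ → γ ≤ γ₁ →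
          ∃ (σ σ₂ : ℕ → ℝ), (∀ J, 0 ≤ σ J) ∧ (∀ J, 0 ≤ σ₂ J) ∧
            (∀ a : ℕ, Tendsto (fun J : ℕ => ((J : ℝ) + 1) ^ a * σ J) atTop (𝓝 0)) ∧
            (∀ a : ℕ, Tendsto (fun J : ℕ => ((J : ℝ) + 1) ^ a * σ₂ J) atTop (𝓝 0)) ∧
            ∀ (ν : ℕ → (j : ℕ) → Measure (GaugeField (F.P j) 0 (Matrix.specialUnitaryGroup (Fin 2) ℂ))),
              (∀ K, ν K K = T4GenFunBounds.gibbsMeasure (F.P K) ((F.scheme ℰp γ).β K)) →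
              (∀ K j, j < K → ν K j = Measure.map (descend F ℰp j) (ν K (j + 1))) →
              ∀ (J K : ℕ) (hJK : J ≤ K) (ρ : GaugeField (F.P J) 0 (Matrix.specialUnitaryGroup (Fin 2) ℂ) → ℝ),
                (∀ U, PlaqSmall (θBal F.L γ b₀ p₀ J) U → 0 < ρ U) →
                ν K J = (fieldMeasure _ _ _).withDensity (fun U => ENNReal.ofReal (ρ U)) →
                ContinuousOn ρ {U | PlaqSmall (θBal F.L γ b₀ p₀ J) U} →
                ∃ (c₀ : ℝ) (d : PBond (F.P J) 0 → PBond (F.P J) 0 → ℝ) (blk : PBond (F.P K) 0 → PBond (F.P J) 0)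
                  (M : GaugeField (F.P J) 0 (Matrix.specialUnitaryGroup (Fin 2) ℂ) → PBond (F.P K) 0 → (Fin 8 → ℝ))
                  (Ncb : ℕ) (_ : NeZero Ncb) (ecb : PBond (F.P J) 0 → TPt 3 (Ncb * Mc))
                  (𝒮 : Finset (TPt 3 Ncb) → (PBond (F.P K) 0 → (Fin 8 → ℂ)) → ℂ)
                  (act : TDom 3 Ncb → (PBond (F.P K) 0 → (Fin 8 → ℂ)) → ℂ),
                  (∀ x y, 0 ≤ d x y) ∧ (∀ x y, d x y = d y x) ∧ (∀ x y z, d x z ≤ d x y + d y z) ∧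
                  (∀ x, ∑ y, Real.exp (-(μ * d x y)) ≤ C) ∧
                  (∀ b b' : PBond (F.P J) 0, κ * (b.src.tdist b'.src : ℝ) ≤ μ * d b b') ∧
                  (∀ c c' : PBond (F.P J) 0, 2 * μ * d c c' ≤ (r₁ / 2 / ((Mc : ℝ) * 3)) * pl1 (ecb c - ecb c')) ∧
                  (∀ (Y : Finset (TPt 3 Ncb)) (q q' : PBond (F.P K) 0 → (Fin 8 → ℂ)),
                      (∀ e, tcubeOf Ncb Mc (ecb (blk e)) ∈ Y → q e = q' e) → 𝒮 Y q = 𝒮 Y q') ∧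
                  (∀ Y : Finset (TPt 3 Ncb), ¬ TFaceConnected Y → ∀ q, 𝒮 Y q = 0) ∧
                  (∀ Y, DifferentiableOn ℂ (𝒮 Y) {q : PBond (F.P K) 0 → (Fin 8 → ℂ) | ∃ U : GaugeField (F.P J) 0 (Matrix.specialUnitaryGroup (Fin 2) ℂ),
                        PlaqSmall (θBal F.L γ b₀ p₀ J) U ∧ dist q (fun e (i : Fin 8) => (M U e i : ℂ)) < 2 * Rₐ}) ∧
                  (∀ Y, ∀ q ∈ {q : PBond (F.P K) 0 → (Fin 8 → ℂ) | ∃ U : GaugeField (F.P J) 0 (Matrix.specialUnitaryGroup (Fin 2) ℂ),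
                        PlaqSmall (θBal F.L γ b₀ p₀ J) U ∧ dist q (fun e (i : Fin 8) => (M U e i : ℂ)) < 2 * Rₐ},
                      ‖𝒮 Y q‖ ≤ As * Real.exp (-r₁ * torusTreeLen Y)) ∧
                  (∀ (Z : TDom 3 Ncb) (q q' : PBond (F.P K) 0 → (Fin 8 → ℂ)),
                      (∀ e, tcubeOf Ncb Mc (ecb (blk e)) ∈ Z.1 → q e = q' e) → act Z q = act Z q') ∧
                  (∀ Z, DifferentiableOn ℂ (act Z) {q : PBond (F.P K) 0 → (Fin 8 → ℂ) | ∃ U : GaugeField (F.P J) 0 (Matrix.specialUnitaryGroup (Fin 2) ℂ),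
                        PlaqSmall (θBal F.L γ b₀ p₀ J) U ∧ dist q (fun e (i : Fin 8) => (M U e i : ℂ)) < 2 * Rₐ}) ∧
                  (∀ Z, ∀ q ∈ {q : PBond (F.P K) 0 → (Fin 8 → ℂ) | ∃ U : GaugeField (F.P J) 0 (Matrix.specialUnitaryGroup (Fin 2) ℂ),
                        PlaqSmall (θBal F.L γ b₀ p₀ J) U ∧ dist q (fun e (i : Fin 8) => (M U e i : ℂ)) < 2 * Rₐ},
                      ‖act Z q‖ ≤ Ag * Real.exp (-(R * torusTreeLen Z.1))) ∧
                  (∀ (U : GaugeField (F.P J) 0 (Matrix.specialUnitaryGroup (Fin 2) ℂ)), PlaqSmall (θBal F.L γ b₀ p₀ J) U →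
                      ∀ Z, (act Z (fun e (i : Fin 8) => (M U e i : ℂ))).im = 0) ∧
                  (∀ (b : PBond (F.P J) 0) (U V : GaugeField (F.P J) 0 (Matrix.specialUnitaryGroup (Fin 2) ℂ)),
                      PlaqSmall (θBal F.L γ b₀ p₀ J) U → PlaqSmall (θBal F.L γ b₀ p₀ J) V → (∀ e, e ≠ b → U e = V e) →
                      ∀ e, ‖M U e - M V e‖ ≤ σ J * Real.exp (-(2 * μ * d b (blk e)))) ∧
                  (∀ (b b' : PBond (F.P J) 0) (U V W Z : GaugeField (F.P J) 0 (Matrix.specialUnitaryGroup (Fin 2) ℂ)),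
                      PlaqSmall (θBal F.L γ b₀ p₀ J) U → PlaqSmall (θBal F.L γ b₀ p₀ J) V →
                      PlaqSmall (θBal F.L γ b₀ p₀ J) W → PlaqSmall (θBal F.L γ b₀ p₀ J) Z →
                      (∀ e, e ≠ b → U e = V e) → (∀ e, e ≠ b' → U e = W e) → (∀ e, e ≠ b' → V e = Z e) → (∀ e, e ≠ b → W e = Z e) →
                      ∀ e, ‖M U e - M W e - M V e + M Z e‖ ≤
                        σ₂ J * (Real.exp (-(2 * μ * d b (blk e))) * Real.exp (-(2 * μ * d (blk e) b')))) ∧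
                  (∀ U : GaugeField (F.P J) 0 (Matrix.specialUnitaryGroup (Fin 2) ℂ), PlaqSmall (θBal F.L γ b₀ p₀ J) U →
                      Real.log (ρ U) + (F.scheme ℰp γ).β K * minActionRegPr F J K hJK ε₀ U =
                        c₀ + ∑ Y, (𝒮 Y (fun e (i : Fin 8) => (M U e i : ℂ))).re +
                          Real.log (polymerPartitionFunction TTouch (fun Z : TDom 3 Ncb => act Z (fun e (i : Fin 8) => (M U e i : ℂ))) Finset.univ).re)) :
    ∀ (L : ℕ), ∃ pS : ℝ, ∀ (b₀ p₀ : ℝ), 0 < b₀ → pS ≤ p₀ → 0 < p₀ → ∃ ε₁ : ℝ, 0 < ε₁ ∧ ∀ (ε₀ : ℝ), 0 < ε₀ → ε₀ ≤ ε₁ →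
      ∃ γ₁ : ℝ, 0 < γ₁ ∧ ∃ (κ μ C A Hc Rₐ : ℝ), 0 < κ ∧ 0 ≤ μ ∧ 0 ≤ A ∧ 0 ≤ Hc ∧ 0 < Rₐ ∧ ∀ (F : T3Family) (γ : ℝ), F.L = L → 0 < γ → γ ≤ γ₁ →
        ∃ (σ σ₂ : ℕ → ℝ), (∀ J, 0 ≤ σ J) ∧ (∀ J, 0 ≤ σ₂ J) ∧
          (∀ a : ℕ, Tendsto (fun J : ℕ => ((J : ℝ) + 1) ^ a * σ J) atTop (𝓝 0)) ∧
          (∀ a : ℕ, Tendsto (fun J : ℕ => ((J : ℝ) + 1) ^ a * σ₂ J) atTop (𝓝 0)) ∧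
          ∀ (ν : ℕ → (j : ℕ) → Measure (GaugeField (F.P j) 0 (Matrix.specialUnitaryGroup (Fin 2) ℂ))),
            (∀ K, ν K K = T4GenFunBounds.gibbsMeasure (F.P K) ((F.scheme ℰp γ).β K)) →
            (∀ K j, j < K → ν K j = Measure.map (descend F ℰp j) (ν K (j + 1))) →
            ∀ (J K : ℕ) (hJK : J ≤ K) (ρ : GaugeField (F.P J) 0 (Matrix.specialUnitaryGroup (Fin 2) ℂ) → ℝ),
              (∀ U, PlaqSmall (θBal F.L γ b₀ p₀ J) U → 0 < ρ U) →
              ν K J = (fieldMeasure _ _ _).withDensity (fun U => ENNReal.ofReal (ρ U)) →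
              ContinuousOn ρ {U | PlaqSmall (θBal F.L γ b₀ p₀ J) U} →
              ∃ (c₀ : ℝ) (d : PBond (F.P J) 0 → PBond (F.P J) 0 → ℝ) (blk : PBond (F.P K) 0 → PBond (F.P J) 0)
                (M : GaugeField (F.P J) 0 (Matrix.specialUnitaryGroup (Fin 2) ℂ) → PBond (F.P K) 0 → (Fin 8 → ℝ))
                (𝒯 : (X : Finset (PBond (F.P J) 0)) → (({e : PBond (F.P K) 0 // blk e ∈ X} → (Fin 8 → ℂ)) → ℂ))
                (Dom : (X : Finset (PBond (F.P J) 0)) → Set ({e : PBond (F.P K) 0 // blk e ∈ X} → (Fin 8 → ℂ)))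
                (Bx : Finset (PBond (F.P J) 0) → ℝ),
                (∀ x y, 0 ≤ d x y) ∧ (∀ x y, d x y = d y x) ∧ (∀ x y z, d x z ≤ d x y + d y z) ∧
                (∀ x, ∑ y, Real.exp (-(μ * d x y)) ≤ C) ∧
                (∀ b b' : PBond (F.P J) 0, κ * (b.src.tdist b'.src : ℝ) ≤ μ * d b b') ∧
                (∀ X, 0 ≤ Bx X) ∧
                (∀ c, ∑ X ∈ Finset.univ.filter (fun X => c ∈ X), Bx X ≤ A) ∧
                (∀ c c', ∑ X ∈ Finset.univ.filter (fun X => c ∈ X ∧ c' ∈ X), Bx X ≤ Hc * Real.exp (-(2 * μ * d c c'))) ∧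
                (∀ X, IsOpen (Dom X)) ∧ (∀ X, DifferentiableOn ℂ (𝒯 X) (Dom X)) ∧
                (∀ X, ∀ p ∈ Dom X, ‖𝒯 X p‖ ≤ Bx X) ∧
                (∀ (X : Finset (PBond (F.P J) 0)) (U : GaugeField (F.P J) 0 (Matrix.specialUnitaryGroup (Fin 2) ℂ)),
                    PlaqSmall (θBal F.L γ b₀ p₀ J) U →
                    Metric.ball (fun (e : {e : PBond (F.P K) 0 // blk e ∈ X}) (i : Fin 8) => (M U e.1 i : ℂ)) (2 * Rₐ) ⊆ Dom X) ∧
                (∀ (b : PBond (F.P J) 0) (U V : GaugeField (F.P J) 0 (Matrix.specialUnitaryGroup (Fin 2) ℂ)),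
                    PlaqSmall (θBal F.L γ b₀ p₀ J) U → PlaqSmall (θBal F.L γ b₀ p₀ J) V → (∀ e, e ≠ b → U e = V e) →
                    ∀ e, ‖M U e - M V e‖ ≤ σ J * Real.exp (-(2 * μ * d b (blk e)))) ∧
                (∀ (b b' : PBond (F.P J) 0) (U V W Z : GaugeField (F.P J) 0 (Matrix.specialUnitaryGroup (Fin 2) ℂ)),
                    PlaqSmall (θBal F.L γ b₀ p₀ J) U → PlaqSmall (θBal F.L γ b₀ p₀ J) V →
                    PlaqSmall (θBal F.L γ b₀ p₀ J) W → PlaqSmall (θBal F.L γ b₀ p₀ J) Z →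
                    (∀ e, e ≠ b → U e = V e) → (∀ e, e ≠ b' → U e = W e) → (∀ e, e ≠ b' → V e = Z e) → (∀ e, e ≠ b → W e = Z e) →
                    ∀ e, ‖M U e - M W e - M V e + M Z e‖ ≤
                      σ₂ J * (Real.exp (-(2 * μ * d b (blk e))) * Real.exp (-(2 * μ * d (blk e) b')))) ∧
                (∀ U : GaugeField (F.P J) 0 (Matrix.specialUnitaryGroup (Fin 2) ℂ), PlaqSmall (θBal F.L γ b₀ p₀ J) U →
                    Real.log (ρ U) + (F.scheme ℰp γ).β K * minActionRegPr F J K hJK ε₀ U = c₀ + ∑ X, (𝒯 X (fun (e : {e : PBond (F.P K) 0 // blk e ∈ X}) (i : Fin 8) => (M U e.1 i : ℂ))).re) := by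
  intro L
  obtain ⟨pS, HpS⟩ := hG L
  refine ⟨pS, fun b₀ p₀ hb₀ hpS hp₀ => ?_⟩
  obtain ⟨ε₁, hε₁, Hε⟩ := HpS b₀ p₀ hb₀ hpS hp₀
  refine ⟨ε₁, hε₁, fun ε₀ hε₀ hε₀₁ => ?_⟩
  obtain ⟨γ₁, hγ₁, κ, μ, C, As, Ag, R, r₁, Rₐ, Mc, instMc, hκ, hμ, hAs, hAg, hRₐ, hr₁κ, hrate, hsmall, HF⟩ := Hε ε₀ hε₀ hε₀₁
  have hκ₀0 : 0 ≤ kappa₀ (4 * 2 ^ 3) (2 * 3) := kappa₀_nonneg (by positivity) _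
  have h2R : (0 : ℝ) < 2 * Rₐ := by positivity
  have hr₁0 : 0 ≤ r₁ := by linarith
  have hK₀c : 0 < K₀ (4 * 2 ^ 3) (2 * 3) := K₀_pos _ _
  set CE : ℝ := Real.exp 1 * 7 * 32 * K₀ (4 * 2 ^ 3) (2 * 3) ^ 2 with hCE
  have hCE0 : 0 ≤ CE := by positivity
  set W : ℝ := As + CE * Ag with hW
  have hW0 : 0 ≤ W := by positivity
  refine ⟨γ₁, hγ₁, κ, μ, C, W * K₀ (4 * 2 ^ 3) (2 * 3), W * Real.exp (3 * (r₁ / 2)) * K₀ (4 * 2 ^ 3) (2 * 3), Rₐ,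
    hκ, hμ, by positivity, by positivity, hRₐ, fun F γ hFL hγ hγ₁' => ?_⟩
  obtain ⟨σ, σ₂, hσ0, hσ₂0, hσ, hσ₂, Hν⟩ := HF F γ hFL hγ hγ₁'
  refine ⟨σ, σ₂, hσ0, hσ₂0, hσ, hσ₂, fun ν hνK hνd J K hJK ρ hρpos hρν hρcont => ?_⟩
  obtain ⟨c₀, d, blk, M, Ncb, instN, ecb, 𝒮, act, hd0, hdsymm, hdtri, hdC, hdκ, hd6,
    h𝒮loc, h𝒮supp, h𝒮hol, h𝒮bd, hactloc, hacthol, hactbd, hactreal, hr1, hr2, hrep⟩ :=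
    Hν ν hνK hνd J K hJK ρ hρpos hρν hρcont
  have hνc : (tgeometry 3 Ncb).ν = 7 := by rw [(tgeometry_consts 3 Ncb).1]; norm_num
  have hc₁c : (tgeometry 3 Ncb).c₁ = 32 := by rw [(tgeometry_consts 3 Ncb).2.2.2]; norm_num
  have hκ₀c : (tgeometry 3 Ncb).κ₀ = kappa₀ (4 * 2 ^ 3) (2 * 3) := (tgeometry_consts 3 Ncb).2.1
  have hK₀c' : (tgeometry 3 Ncb).K₀ = K₀ (4 * 2 ^ 3) (2 * 3) := (tgeometry_consts 3 Ncb).2.2.1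
  have hrate' : r₁ + 2 * (tgeometry 3 Ncb).κ₀ + 2 ≤ R := by rw [hκ₀c]; exact hrate
  have hsmall' : Ag * Real.exp (5 * r₁ + 1) * (tgeometry 3 Ncb).K₀ * (tgeometry 3 Ncb).ν * (tgeometry 3 Ncb).c₁ ≤ 1 := by
    rw [hK₀c', hνc, hc₁c]; exact hsmall
  have hCE' : Real.exp 1 * (tgeometry 3 Ncb).ν * (tgeometry 3 Ncb).c₁ * (tgeometry 3 Ncb).K₀ ^ 2 * Ag = CE * Ag := by
    rw [hνc, hc₁c, hK₀c', hCE]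
  set 𝒲 : Set (PBond (F.P K) 0 → (Fin 8 → ℂ)) := {q | ∃ U : GaugeField (F.P J) 0 (Matrix.specialUnitaryGroup (Fin 2) ℂ),
    PlaqSmall (θBal F.L γ b₀ p₀ J) U ∧ dist q (fun e (i : Fin 8) => (M U e i : ℂ)) < 2 * Rₐ} with h𝒲
  set cb : PBond (F.P J) 0 → TPt 3 Ncb := fun c => tcubeOf Ncb Mc (ecb c) with hcb
  set bs : Finset (TPt 3 Ncb) → Finset (PBond (F.P J) 0) := fun Y => Finset.univ.filter (fun c => cb c ∈ Y) with hbs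
  set ext0 : (X : Finset (PBond (F.P J) 0)) → ({e : PBond (F.P K) 0 // blk e ∈ X} → (Fin 8 → ℂ)) → (PBond (F.P K) 0 → (Fin 8 → ℂ)) :=
    fun X p e => if h : blk e ∈ X then p ⟨e, h⟩ else 0 with hext0
  set extU : (X : Finset (PBond (F.P J) 0)) → GaugeField (F.P J) 0 (Matrix.specialUnitaryGroup (Fin 2) ℂ) →
      ({e : PBond (F.P K) 0 // blk e ∈ X} → (Fin 8 → ℂ)) → (PBond (F.P K) 0 → (Fin 8 → ℂ)) :=
    fun X U p e => if h : blk e ∈ X then p ⟨e, h⟩ else (M U e · : Fin 8 → ℂ) with hextU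
  set Eg : (PBond (F.P K) 0 → (Fin 8 → ℂ)) → Finset (TPt 3 Ncb) → ℂ :=
    fun q Y => locE TTouch (fun Z : TDom 3 Ncb => Z.1) (fun Z => act Z q) Y with hEg
  set wY : Finset (TPt 3 Ncb) → ℝ := fun Y => if TFaceConnected Y then W * Real.exp (-r₁ * torusTreeLen Y) else 0 with hwY
  have hwY0 : ∀ Y, 0 ≤ wY Y := fun Y => by
    simp only [hwY]; split_ifs; exacts [mul_nonneg hW0 (Real.exp_nonneg _), le_rfl]
  have hextU_diff : ∀ X U, Differentiable ℂ (extU X U) := fun X U => differentiable_cellExt blk X (fun e => (M U e · : Fin 8 → ℂ))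
  have hext0_on : ∀ (X : Finset (PBond (F.P J) 0)) (p : {e : PBond (F.P K) 0 // blk e ∈ X} → (Fin 8 → ℂ)) (e : PBond (F.P K) 0)
      (h : blk e ∈ X), ext0 X p e = p ⟨e, h⟩ := fun X p e h => by simp only [hext0, dif_pos h]
  have hextU_on : ∀ (X : Finset (PBond (F.P J) 0)) U (p : {e : PBond (F.P K) 0 // blk e ∈ X} → (Fin 8 → ℂ)) (e : PBond (F.P K) 0)
      (h : blk e ∈ X), extU X U p e = p ⟨e, h⟩ := fun X U p e h => by simp only [hextU, dif_pos h]
  have hextU_off : ∀ (X : Finset (PBond (F.P J) 0)) U (p : {e : PBond (F.P K) 0 // blk e ∈ X} → (Fin 8 → ℂ)) (e : PBond (F.P K) 0)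
      (h : blk e ∉ X), extU X U p e = (M U e · : Fin 8 → ℂ) := fun X U p e h => by simp only [hextU, dif_neg h]
  have hextU_mem : ∀ (X : Finset (PBond (F.P J) 0)) U (p : {e : PBond (F.P K) 0 // blk e ∈ X} → (Fin 8 → ℂ)),
      PlaqSmall (θBal F.L γ b₀ p₀ J) U →
      dist p (fun (e : {e : PBond (F.P K) 0 // blk e ∈ X}) (i : Fin 8) => (M U e.1 i : ℂ)) < 2 * Rₐ → extU X U p ∈ 𝒲 := by
    intro X U p hU hp
    refine ⟨U, hU, ?_⟩
    rw [dist_pi_lt_iff h2R]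
    intro e
    by_cases h : blk e ∈ X
    · rw [hextU_on X U p e h]
      have hle := dist_le_pi_dist p (fun (e' : {e : PBond (F.P K) 0 // blk e ∈ X}) (i : Fin 8) => (M U e'.1 i : ℂ)) ⟨e, h⟩
      exact lt_of_le_of_lt hle hp
    · rw [hextU_off X U p e h, dist_self]
      exact h2R
  have hfib : ∀ (X : Finset (PBond (F.P J) 0)) U (p : {e : PBond (F.P K) 0 // blk e ∈ X} → (Fin 8 → ℂ)),
      ∀ Y ∈ Finset.univ.filter (fun Y => bs Y = X),
        𝒮 Y (ext0 X p) + Eg (ext0 X p) Y = 𝒮 Y (extU X U p) + Eg (extU X U p) Y := by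
    intro X U p Y hY
    have hYX : bs Y = X := (Finset.mem_filter.mp hY).2
    have hagree : ∀ e, cb (blk e) ∈ Y → ext0 X p e = extU X U p e := by
      intro e he
      have hbX : blk e ∈ X := by rw [← hYX]; exact Finset.mem_filter.mpr ⟨Finset.mem_univ _, he⟩
      rw [hext0_on X p e hbX, hextU_on X U p e hbX]
    have hS : 𝒮 Y (ext0 X p) = 𝒮 Y (extU X U p) := h𝒮loc Y _ _ hagree
    have hE : Eg (ext0 X p) Y = Eg (extU X U p) Y :=
      locE_congr TTouch fun Z hZ => hactloc Z _ _ fun e he => hagree e (hZ he)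
    rw [hS, hE]
  have hhol' : ∀ (X : Finset (PBond (F.P J) 0)) U, PlaqSmall (θBal F.L γ b₀ p₀ J) U → ∀ Z : TDom 3 Ncb,
      DifferentiableOn ℂ (fun p => (fun p Z => act Z (extU X U p)) p Z)
        (Metric.ball (fun (e : {e : PBond (F.P K) 0 // blk e ∈ X}) (i : Fin 8) => (M U e.1 i : ℂ)) (2 * Rₐ)) :=
    fun X U hU Z => (hacthol Z).comp (hextU_diff X U).differentiableOn (fun p hp => hextU_mem X U p hU (Metric.mem_ball.1 hp))
  have hbd' : ∀ (X : Finset (PBond (F.P J) 0)) U, PlaqSmall (θBal F.L γ b₀ p₀ J) U →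
      ∀ p ∈ Metric.ball (fun (e : {e : PBond (F.P K) 0 // blk e ∈ X}) (i : Fin 8) => (M U e.1 i : ℂ)) (2 * Rₐ),
      ∀ Z : TDom 3 Ncb, ‖(fun p Z => act Z (extU X U p)) p Z‖ ≤ Ag * Real.exp (-(R * torusTreeLen Z.1)) :=
    fun X U hU p hp Z => hactbd Z (extU X U p) (hextU_mem X U p hU (Metric.mem_ball.1 hp))
  have hopen : ∀ X : Finset (PBond (F.P J) 0), IsOpen {p : {e : PBond (F.P K) 0 // blk e ∈ X} → (Fin 8 → ℂ) |
      ∃ U : GaugeField (F.P J) 0 (Matrix.specialUnitaryGroup (Fin 2) ℂ), PlaqSmall (θBal F.L γ b₀ p₀ J) U ∧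
        dist p (fun (e : {e : PBond (F.P K) 0 // blk e ∈ X}) (i : Fin 8) => (M U e.1 i : ℂ)) < 2 * Rₐ} := by
    intro X
    have hset : {p : {e : PBond (F.P K) 0 // blk e ∈ X} → (Fin 8 → ℂ) |
        ∃ U : GaugeField (F.P J) 0 (Matrix.specialUnitaryGroup (Fin 2) ℂ), PlaqSmall (θBal F.L γ b₀ p₀ J) U ∧
          dist p (fun (e : {e : PBond (F.P K) 0 // blk e ∈ X}) (i : Fin 8) => (M U e.1 i : ℂ)) < 2 * Rₐ} =
        ⋃ U ∈ {U : GaugeField (F.P J) 0 (Matrix.specialUnitaryGroup (Fin 2) ℂ) | PlaqSmall (θBal F.L γ b₀ p₀ J) U},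
          Metric.ball (fun (e : {e : PBond (F.P K) 0 // blk e ∈ X}) (i : Fin 8) => (M U e.1 i : ℂ)) (2 * Rₐ) := by
      ext p
      simp only [Set.mem_setOf_eq, Set.mem_iUnion, Metric.mem_ball, exists_prop]
    rw [hset]
    exact isOpen_biUnion fun U _ => Metric.isOpen_ball
  refine ⟨c₀, d, blk, M,
    fun X p => ∑ Y ∈ Finset.univ.filter (fun Y => bs Y = X), (𝒮 Y (ext0 X p) + Eg (ext0 X p) Y),
    fun X => {p | ∃ U : GaugeField (F.P J) 0 (Matrix.specialUnitaryGroup (Fin 2) ℂ), PlaqSmall (θBal F.L γ b₀ p₀ J) U ∧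
      dist p (fun (e : {e : PBond (F.P K) 0 // blk e ∈ X}) (i : Fin 8) => (M U e.1 i : ℂ)) < 2 * Rₐ},
    fun X => ∑ Y ∈ Finset.univ.filter (fun Y => bs Y = X), wY Y,
    hd0, hdsymm, hdtri, hdC, hdκ, fun X => Finset.sum_nonneg fun Y _ => hwY0 Y, ?_, ?_, hopen, ?_, ?_, ?_, hr1, hr2, ?_⟩
  · -- one-pin sum: regroup by cube polymer, then (1.26) at the cube of `c`
    intro c
    rw [Finset.sum_fiberwise_eq_sum_filter Finset.univ (Finset.univ.filter (fun X => c ∈ X)) bs wY]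
    have hmem : ∀ Y, bs Y ∈ Finset.univ.filter (fun X => c ∈ X) ↔ cb c ∈ Y := by
      intro Y; simp only [Finset.mem_filter, Finset.mem_univ, true_and, hbs]
    have hpt : ∀ Y ∈ Finset.univ.filter (fun Y => bs Y ∈ Finset.univ.filter (fun X => c ∈ X)),
        wY Y ≤ if cb c ∈ Y ∧ TFaceConnected Y then W * Real.exp (-r₁ * torusTreeLen Y) else 0 := by
      intro Y hY
      have hcY : cb c ∈ Y := (hmem Y).mp (Finset.mem_filter.mp hY).2
      by_cases hfc : TFaceConnected Y
      · rw [if_pos ⟨hcY, hfc⟩]; simp only [hwY, if_pos hfc, le_refl]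
      · rw [if_neg (fun h => hfc h.2)]; simp only [hwY, if_neg hfc, le_refl]
    refine (Finset.sum_le_sum hpt).trans ?_
    rw [← Finset.sum_filter, Finset.filter_filter]
    have hfam : Finset.univ.filter (fun Y => bs Y ∈ Finset.univ.filter (fun X => c ∈ X) ∧ (cb c ∈ Y ∧ TFaceConnected Y))
        = Finset.univ.filter (fun Y => cb c ∈ Y ∧ TFaceConnected Y) := by
      refine Finset.filter_congr fun Y _ => ?_
      rw [hmem Y]; tauto
    rw [hfam, ← Finset.mul_sum]
    have hκ1 : kappa₀ (4 * 2 ^ 3) (2 * 3) ≤ r₁ := by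
      have h2 := hr₁κ; set qκ : ℝ := kappa₀ (4 * 2 ^ 3) (2 * 3); linarith
    exact mul_le_mul_of_nonneg_left (sum_exp_torusTreeLen_le 3 Ncb (cb c) hκ1) hW0
  · -- two-pin sum: regroup, (1.26) at two marked cubes in site currency, then (d6)
    intro c c'
    rw [Finset.sum_fiberwise_eq_sum_filter Finset.univ (Finset.univ.filter (fun X => c ∈ X ∧ c' ∈ X)) bs wY]
    have hmem : ∀ Y, bs Y ∈ Finset.univ.filter (fun X => c ∈ X ∧ c' ∈ X) ↔ cb c ∈ Y ∧ cb c' ∈ Y := by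
      intro Y; simp only [Finset.mem_filter, Finset.mem_univ, true_and, hbs]
    have hpt : ∀ Y ∈ Finset.univ.filter (fun Y => bs Y ∈ Finset.univ.filter (fun X => c ∈ X ∧ c' ∈ X)),
        wY Y ≤ if cb c ∈ Y ∧ cb c' ∈ Y ∧ TFaceConnected Y then W * Real.exp (-r₁ * torusTreeLen Y) else 0 := by
      intro Y hY
      have hcY : cb c ∈ Y ∧ cb c' ∈ Y := (hmem Y).mp (Finset.mem_filter.mp hY).2
      by_cases hfc : TFaceConnected Y
      · rw [if_pos ⟨hcY.1, hcY.2, hfc⟩]; simp only [hwY, if_pos hfc, le_refl]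
      · rw [if_neg (fun h => hfc h.2.2)]; simp only [hwY, if_neg hfc, le_refl]
    refine (Finset.sum_le_sum hpt).trans ?_
    rw [← Finset.sum_filter, Finset.filter_filter]
    have hfam : Finset.univ.filter (fun Y => bs Y ∈ Finset.univ.filter (fun X => c ∈ X ∧ c' ∈ X) ∧ (cb c ∈ Y ∧ cb c' ∈ Y ∧ TFaceConnected Y))
        = Finset.univ.filter (fun Y => cb c ∈ Y ∧ cb c' ∈ Y ∧ TFaceConnected Y) := by
      refine Finset.filter_congr fun Y _ => ?_
      rw [hmem Y]; tauto
    rw [hfam, ← Finset.mul_sum]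
    have hκ2 : kappa₀ (4 * 2 ^ 3) (2 * 3) ≤ r₁ / 2 := by
      have h2 := hr₁κ; set qκ : ℝ := kappa₀ (4 * 2 ^ 3) (2 * 3); linarith
    have htwo := sum_exp_torusTreeLen_two_sites_le 3 Ncb Mc (by norm_num) (ecb c) (ecb c') hκ2
    have hexp : Real.exp (-(r₁ / 2 / ((Mc : ℝ) * (3 : ℕ))) * pl1 (ecb c - ecb c')) ≤ Real.exp (-(2 * μ * d c c')) := by
      refine Real.exp_le_exp.2 ?_
      have h6 := hd6 c c'
      have h3 : ((Mc : ℝ) * (3 : ℕ)) = (Mc : ℝ) * 3 := by push_cast; ring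
      rw [h3]; linarith
    calc W * ∑ Y ∈ Finset.univ.filter (fun Y => cb c ∈ Y ∧ cb c' ∈ Y ∧ TFaceConnected Y), Real.exp (-r₁ * torusTreeLen Y)
        ≤ W * (Real.exp (3 * (r₁ / 2)) * Real.exp (-(r₁ / 2 / ((Mc : ℝ) * (3 : ℕ))) * pl1 (ecb c - ecb c')) * K₀ (4 * 2 ^ 3) (2 * 3)) :=
          mul_le_mul_of_nonneg_left htwo hW0
      _ ≤ W * (Real.exp (3 * (r₁ / 2)) * Real.exp (-(2 * μ * d c c')) * K₀ (4 * 2 ^ 3) (2 * 3)) := by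
          gcongr
      _ = W * Real.exp (3 * (r₁ / 2)) * K₀ (4 * 2 ^ 3) (2 * 3) * Real.exp (-(2 * μ * d c c')) := by ring
  · -- joint holomorphy on `Dom X`: local on each ball about `M U|_X`, where the term is read through the `U`-glue
    intro X p hp
    obtain ⟨U, hU, hpU⟩ := hp
    have hball : DifferentiableOn ℂ
        (fun p => ∑ Y ∈ Finset.univ.filter (fun Y => bs Y = X), (𝒮 Y (extU X U p) + Eg (extU X U p) Y))
        (Metric.ball (fun (e : {e : PBond (F.P K) 0 // blk e ∈ X}) (i : Fin 8) => (M U e.1 i : ℂ)) (2 * Rₐ)) := by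
      refine DifferentiableOn.fun_sum fun Y _ => DifferentiableOn.add ?_ ?_
      · exact (h𝒮hol Y).comp (hextU_diff X U).differentiableOn (fun p hp => hextU_mem X U p hU (Metric.mem_ball.1 hp))
      · exact differentiableOn_locE_param_tthree (N := Ncb) (fun p Z => act Z (extU X U p)) Metric.isOpen_ball hAg hr₁0 hrate' hsmall'
          (hhol' X U hU) (hbd' X U hU) Y
    have hball' : DifferentiableOn ℂ
        (fun p => ∑ Y ∈ Finset.univ.filter (fun Y => bs Y = X), (𝒮 Y (ext0 X p) + Eg (ext0 X p) Y))
        (Metric.ball (fun (e : {e : PBond (F.P K) 0 // blk e ∈ X}) (i : Fin 8) => (M U e.1 i : ℂ)) (2 * Rₐ)) :=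
      hball.congr fun p _ => Finset.sum_congr rfl fun Y hY => hfib X U p Y hY
    exact (hball'.differentiableAt (Metric.isOpen_ball.mem_nhds (Metric.mem_ball.2 hpU))).differentiableWithinAt
  · -- the envelope `‖𝒯 X p‖ ≤ Bx X` on `Dom X`
    intro X p hp
    obtain ⟨U, hU, hpU⟩ := hp
    have hpB : p ∈ Metric.ball (fun (e : {e : PBond (F.P K) 0 // blk e ∈ X}) (i : Fin 8) => (M U e.1 i : ℂ)) (2 * Rₐ) :=
      Metric.mem_ball.2 hpU
    show ‖∑ Y ∈ Finset.univ.filter (fun Y => bs Y = X), (𝒮 Y (ext0 X p) + Eg (ext0 X p) Y)‖ ≤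
      ∑ Y ∈ Finset.univ.filter (fun Y => bs Y = X), wY Y
    rw [Finset.sum_congr rfl fun Y hY => hfib X U p Y hY]
    refine (norm_sum_le _ _).trans (Finset.sum_le_sum fun Y _ => ?_)
    by_cases hfc : TFaceConnected Y
    · simp only [hwY, if_pos hfc]
      refine (norm_add_le _ _).trans ?_
      have h1 : ‖𝒮 Y (extU X U p)‖ ≤ As * Real.exp (-r₁ * torusTreeLen Y) := h𝒮bd Y (extU X U p) (hextU_mem X U p hU hpU)
      have h2 : ‖Eg (extU X U p) Y‖ ≤ CE * Ag * Real.exp (-r₁ * torusTreeLen Y) := by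
        have := norm_locE_param_le_tthree (N := Ncb) (fun p Z => act Z (extU X U p)) Metric.isOpen_ball hAg hr₁0 hrate' hsmall'
          (hhol' X U hU) (hbd' X U hU) Y hpB
        rw [hCE'] at this
        exact this
      calc ‖𝒮 Y (extU X U p)‖ + ‖Eg (extU X U p) Y‖
          ≤ As * Real.exp (-r₁ * torusTreeLen Y) + CE * Ag * Real.exp (-r₁ * torusTreeLen Y) := add_le_add h1 h2
        _ = W * Real.exp (-r₁ * torusTreeLen Y) := by rw [hW]; ring
    · simp only [hwY, if_neg hfc]
      have h1 : 𝒮 Y (extU X U p) = 0 := h𝒮supp Y hfc _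
      have h2 : Eg (extU X U p) Y = 0 :=
        locE_param_eq_zero_of_not_tFaceConnected (N := Ncb) (fun p Z => act Z (extU X U p)) hAg hr₁0 hrate' hsmall'
          (p := p) (fun Z => hbd' X U hU p hpB Z) hfc
      rw [h1, h2, add_zero, norm_zero]
  · -- the collar of BGFORMᵃ∘ v2: the ball about `M U|_X` lies in `Dom X` by definition
    intro X U hU p hp
    exact ⟨U, hU, Metric.mem_ball.1 hp⟩
  · -- the representation: locality puts every term at the real registers `M U ↪ ℂ⁸`, fibrewise regrouping, and the last Mayer step at real activities
    intro U hU
    set q₀ : PBond (F.P K) 0 → (Fin 8 → ℂ) := fun e (i : Fin 8) => (M U e i : ℂ) with hq₀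
    have hq₀W : q₀ ∈ 𝒲 := ⟨U, hU, by rw [hq₀, dist_self]; exact h2R⟩
    obtain ⟨-, -, hlog⟩ := locE_param_real (N := Ncb) (P := PBond (F.P K) 0 → (Fin 8 → ℂ)) (fun q Z => act Z q)
      hAg hr₁0 hrate' hsmall' (p := q₀) (fun Z => hactbd Z q₀ hq₀W) (hactreal U hU)
    have key : ∀ X : Finset (PBond (F.P J) 0), ∀ Y ∈ Finset.univ.filter (fun Y => bs Y = X),
        𝒮 Y (ext0 X (fun (e : {e : PBond (F.P K) 0 // blk e ∈ X}) (i : Fin 8) => (M U e.1 i : ℂ))) +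
            Eg (ext0 X (fun (e : {e : PBond (F.P K) 0 // blk e ∈ X}) (i : Fin 8) => (M U e.1 i : ℂ))) Y
          = 𝒮 Y q₀ + Eg q₀ Y := by
      intro X Y hY
      have hYX : bs Y = X := (Finset.mem_filter.mp hY).2
      have hagree : ∀ e, cb (blk e) ∈ Y →
          ext0 X (fun (e : {e : PBond (F.P K) 0 // blk e ∈ X}) (i : Fin 8) => (M U e.1 i : ℂ)) e = q₀ e := by
        intro e he
        have hbX : blk e ∈ X := by rw [← hYX]; exact Finset.mem_filter.mpr ⟨Finset.mem_univ _, he⟩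
        exact hext0_on X (fun (e' : {e : PBond (F.P K) 0 // blk e ∈ X}) (i : Fin 8) => (M U e'.1 i : ℂ)) e hbX
      have hS : 𝒮 Y (ext0 X (fun (e : {e : PBond (F.P K) 0 // blk e ∈ X}) (i : Fin 8) => (M U e.1 i : ℂ))) = 𝒮 Y q₀ :=
        h𝒮loc Y _ _ hagree
      have hE : Eg (ext0 X (fun (e : {e : PBond (F.P K) 0 // blk e ∈ X}) (i : Fin 8) => (M U e.1 i : ℂ))) Y = Eg q₀ Y :=
        locE_congr TTouch fun Z hZ => hactloc Z _ _ fun e he => hagree e (hZ he)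
      rw [hS, hE]
    rw [hrep U hU, hlog]
    have hsum : ∑ X : Finset (PBond (F.P J) 0), (∑ Y ∈ Finset.univ.filter (fun Y => bs Y = X),
        (𝒮 Y (ext0 X (fun (e : {e : PBond (F.P K) 0 // blk e ∈ X}) (i : Fin 8) => (M U e.1 i : ℂ))) +
          Eg (ext0 X (fun (e : {e : PBond (F.P K) 0 // blk e ∈ X}) (i : Fin 8) => (M U e.1 i : ℂ))) Y)).re
        = ∑ Y : Finset (TPt 3 Ncb), ((𝒮 Y q₀).re + (Eg q₀ Y).re) := by
      rw [← Finset.sum_fiberwise Finset.univ bs (fun Y => (𝒮 Y q₀).re + (Eg q₀ Y).re)]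
      refine Finset.sum_congr rfl fun X _ => ?_
      rw [Complex.re_sum]
      refine Finset.sum_congr rfl fun Y hY => ?_
      rw [key X Y hY, Complex.add_re]
    rw [hsum, Finset.sum_add_distrib]
    ring

end Summit.QuantumFields.YangMills.Theorems.FluctuationComparisonRegPrIntLBackgroundFormCellGasCollarKnit

end
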